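import Summits.QuantumFields.YangMills.Theorems.UnitScaleTiltProp7HessOnPrintSlice
import Summits.QuantumFields.YangMills.Theorems.UnitScaleTiltProp7SectET3GaugeProjectorT3Rows
import Summits.QuantumFields.YangMills.Theorems.UnitScaleTiltProp7SectET3OpsT3HilbertRows
import HarnessLib

/-!
# Route `UnitScaleTilt`, crux K1 «MinimiserStabilityRegPr» (stmt-QuantumFields-19200) — route-R E′ growth side under RULING g28-№13 (architecture (A′) HCOW-VIA-Σ):
# **THE QUANTITATIVE COERCIVITY ROW OF `Δ_a(W)` IS «ALMOST-POSITIVITY + AN L² INVERSE BOUND»** — for a Hermitian operator `T` on a finite-dimensional inner-product space,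
# `re⟨y,Ty⟩ ≥ −θ‖y‖²`, `‖y‖ ≤ B‖Ty‖` and `θB < 1` give `re⟨y,Ty⟩ ≥ B⁻¹‖y‖²`; read at the member's `Δ_a(U₀) = Δx(U₀) + D R_S D* + Q_k†aQ_k` ([Balaban1985BackgroundPropagators] (3.26))

Cell `ym3-torus`, width seat `ym-ust-19200-w4` (gen 8); ★★OWNER RULING g28-№13 (3) «w4 g8: R-CORE LOCATE GO» → this seat's `LOCATE-RCORE-w4g8.md` (19200 evidence #57) item (R2)∕T1,
typed at own risk.  THEOREMS ONLY (0 `def`, 0 `sorry`); `--supports stmt-QuantumFields-19200`, count-neutral.  YM₃ on T³ is a ladder rung (R3), not the Clay problem; nothing here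
claims [Balaban1985BackgroundPropagators] Thm 3.3∕3.10∕3.11 at a curved background, HESS, `hcoW`, E′, EX, a stub, the crux, d = 4 or the mass gap.

WHY.  RULING №13 (2) accepts ONE displayed analytic input for the E′ growth side: a quantitative coercivity row «`γ(L)·‖y‖² ≤ re⟪y, Δ_a(W) y⟫`» ([Balaban1985BackgroundPropagators]
Thm 3.11 + the `L²` bound of Thm 3.3), to be fed to ✓`Prop7HessOnPrintSlice.hess_of_laplaceA_coercive_of_isLandauPrintS(_of_ker)`.  Print proves Thm 3.11 (p. 416) not by an
estimate but from INVERTIBILITY with a bounded inverse («G … is a symmetric and invertible operator, so if it is not positive, then there exists A₀ ≠ 0, λ₀ > 0 such that GA₀ = −λ₀A₀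
…»).  The same spectral sentence, one step shorter, is this file's §1: a Hermitian `T` whose quadratic form is bounded below by `−θ` and whose inverse is bounded by `B` with `θB < 1`
has ALL eigenvalues `≥ 1∕B` (each eigenvalue has `|λ| ≥ 1∕B` and `λ ≥ −θ > −1∕B`), hence `re⟨y,Ty⟩ ≥ B⁻¹‖y‖²`.  At `T = Δ_a(U₀)` (§2) the two penalties `‖R_S D*y‖²`, `a‖Q_ky‖²` are
non-negative, so almost-positivity of `Δ_a` is almost-positivity of the Hessian letter `Δx(U₀)` alone — for print's `Δ^η = 𝒟*𝒟 + Δ′` ((3.10), «Δ′ will be a bounded, small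
operator») that is `θ = ‖Δ′‖ = O(sup η⁻²|Im U₀(∂p)|)`, tiny on the regular class (6)(e) — and the inverse bound is the `L²` clause (3.46)–(3.47) of Thm 3.3 for `G = Δ_a⁻¹` ((3.27)).
So the ruling's quantitative row is, BY KERNEL, {an `L²` `norm_G₀` row at the slot of the EX display's `hPosΔ`} + {almost-positivity of `Δx`}, with `γ := 1∕B₀` BY NAME; and the EX
display's QUALITATIVE `hPosΔ` (`0 < re⟪x, Δ_a x⟫`, `x ≠ 0`) follows from the same two rows (§2 `pos_laplaceA_of_almostPos_of_inverse_bound`).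

WHAT IS PROVED (ns `…Theorems.Prop7CoerciveOfInverseBound`).
§1 (any `RCLike 𝕜`, finite-dimensional inner-product space; Mathlib's `LinearMap.IsSymmetric.eigenvectorBasis`): `re_inner_eq_sum_eigenvalues` (`re⟨y,Ty⟩ = Σᵢ λᵢ‖cᵢ‖²`),
★★ `eigenvalues_ge_of_almostPos_of_inv_bound` (`λᵢ ≥ B⁻¹`), ★★★ `re_inner_ge_of_almostPos_of_inv_bound` (`B⁻¹‖y‖² ≤ re⟨y,Ty⟩`), `re_inner_ge_of_nonneg_of_inv_bound` (`θ = 0`),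
`inv_bound_of_rightInverse` (`T∘S = id ∧ ‖Sf‖ ≤ B‖f‖ ⇒ ‖y‖ ≤ B‖Ty‖`, finite dimension).
§2 (the member's `laplaceA F n K h c₀ cB a Δx U₀` of ✓`Prop7SectET3CurvedPropagators`; symmetry by name from ✓`Prop7SectET3OpsT3HilbertRows.laplaceA_isSymmetric`, ✓`RS_isSymmetric`,
✓`RS_RS`): `re_inner_RS_self` (`re⟨u, R_S u⟩ = ‖R_S u‖²`), ★ `re_inner_laplaceA_eq`
(`re⟨y,Δ_a y⟩ = re⟨y,Δx y⟩ + ‖R_S D*y‖² + a‖Q_k y‖²`), `almostPos_laplaceA_of_almostPos`, ★★★ `coercive_laplaceA_of_almostPos_of_inverse_bound` (THE ROW: `B⁻¹‖y‖² ≤ re⟨y, Δ_a(U₀)y⟩`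
from `−θ‖y‖² ≤ re⟨y, Δx(U₀)y⟩`, a right inverse `G₀` of `Δ_a(U₀)` with `‖G₀f‖ ≤ B‖f‖`, `θB < 1`, `0 ≤ a`), `pos_laplaceA_of_almostPos_of_inverse_bound` (the EX display's `hPosΔ` shape),
★★ `hess_of_almostPos_of_inverse_bound_of_isLandauPrintS_of_ker` (composition with ✓p686677: `B⁻¹‖X̃‖² ≤ re⟨X̃, Δx(U₀)X̃⟩` on print's slice ∩ `ker Q_k`).
HONEST SCOPE.  Linear algebra; the inverse bound and the almost-positivity of `Δx(U₀)` are HYPOTHESES (N06-class resp. the (3.10)-identification row of the EX lane's `DeltaEtaSlot`);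
nothing of Thm 3.3∕3.11 at curved `U₀`, of HESS at `IsCritR2`, `hcoW`, E′, EX or the crux is claimed; rung R3, not Clay; YM gap NOT proved.

References: T. Bałaban, CMP 99 (1985) 389–434 [Balaban1985BackgroundPropagators] ((3.10)–(3.12) p.392, (3.26)–(3.27) p.395, Thm 3.3 p.399, (3.46)–(3.47) p.398, Thm 3.11 and
its proof p.416); CMP 102 (1985) 277–309 [Balaban1985Variational] ((110)–(111) p.294, (141)–(142) p.299); CMP 95 (1984) 17–40 [Balaban1984PropagatorsI] (Prop. 1.1 (1.90) p.33).
-/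

set_option autoImplicit false

noncomputable section

open scoped InnerProductSpace ComplexConjugate BigOperators

namespace Summit.QuantumFields.YangMills.Theorems.Prop7CoerciveOfInverseBound

open Literature.MathematicalPhysics.QuantumFieldTheory.Balaban1983to89
open Literature.MathematicalPhysics.QuantumFieldTheory.Balaban1983to89.T3ContinuumYM3Torus
open B11Eq103H1Complex (SiteL2K BondL2K laplaceAK laplaceAK_apply)
open B9Eq311L2Pairing (WL2)
open Summit.QuantumFields.YangMills.Theorems.Prop7SectET3Transport (periodsT3)
open Summit.QuantumFields.YangMills.Theorems.Prop7SectET3HilbertLetters (W₂ toL2 DL2 DstarL2 adjoint_DL2)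
open Summit.QuantumFields.YangMills.Theorems.Prop7SectET3GaugeProjector (RS RS_eq_projR RS_isSymmetric RS_RS)
open Summit.QuantumFields.YangMills.Theorems.Prop7SectET3CurvedPropagators (Qk laplaceA)
open Summit.QuantumFields.YangMills.Theorems.Prop7SPrint (IsLandauPrintS)
open Summit.QuantumFields.YangMills.Theorems.Prop7HessOnPrintSlice (laplaceA_eq_laplaceAK hess_of_laplaceA_coercive_of_isLandauPrintS_of_ker)
open Summit.QuantumFields.YangMills.Theorems.Prop7SectET3OpsT3HilbertRows (laplaceA_isSymmetric)

/-! ## §1 The spectral sentence: almost-positivity + an inverse bound ⟹ coercivity -/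

section Abstract

variable {𝕜 : Type*} [RCLike 𝕜] {E : Type*} [NormedAddCommGroup E] [InnerProductSpace 𝕜 E] [FiniteDimensional 𝕜 E]

/-- **The quadratic form of a symmetric operator in its orthonormal eigenbasis**: `re⟨y, Ty⟩ = Σᵢ λᵢ·‖cᵢ‖²`, `cᵢ` the coordinates of `y` (Mathlib's spectral theorem
`LinearMap.IsSymmetric.eigenvectorBasis_apply_self_apply`). [folklore] [cite: Balaban1985BackgroundPropagators, Thm 3.11 proof p.416] -/
theorem re_inner_eq_sum_eigenvalues {T : E →ₗ[𝕜] E} (hT : T.IsSymmetric) {n : ℕ} (hn : Module.finrank 𝕜 E = n) (y : E) :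
    RCLike.re ⟪y, T y⟫_𝕜 = ∑ i, hT.eigenvalues hn i * ‖(hT.eigenvectorBasis hn).repr y i‖ ^ 2 := by
  have h1 : ⟪y, T y⟫_𝕜 = ⟪(hT.eigenvectorBasis hn).repr y, (hT.eigenvectorBasis hn).repr (T y)⟫_𝕜 :=
    ((hT.eigenvectorBasis hn).repr.inner_map_map y (T y)).symm
  rw [h1, PiLp.inner_apply, map_sum]
  refine Finset.sum_congr rfl fun i _ => ?_
  rw [hT.eigenvectorBasis_apply_self_apply hn y i, RCLike.inner_apply, mul_assoc, RCLike.mul_conj, ← RCLike.ofReal_pow,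
    ← RCLike.ofReal_mul, RCLike.ofReal_re]

/-- ★★ **EVERY EIGENVALUE IS `≥ 1∕B`**: if the symmetric `T` has `re⟨y,Ty⟩ ≥ −θ‖y‖²` for all `y`, `‖y‖ ≤ B·‖Ty‖` for all `y` (`B > 0`), and `θB < 1`, then each eigenvalue `λᵢ`
of `T` satisfies `B⁻¹ ≤ λᵢ` — at the unit eigenvector `1 ≤ B|λᵢ|` and `−θ ≤ λᵢ`, and `−θ > −1∕B` excludes the negative branch (print, p.416: «if it is not positive, then there
exists A₀ ≠ 0, λ₀ > 0 such that GA₀ = −λ₀A₀ … contradiction»). [cite: Balaban1985BackgroundPropagators, Thm 3.11 proof p.416] -/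
theorem eigenvalues_ge_of_almostPos_of_inv_bound {T : E →ₗ[𝕜] E} (hT : T.IsSymmetric) {n : ℕ} (hn : Module.finrank 𝕜 E = n)
    {θ B : ℝ} (hB : 0 < B) (hθB : θ * B < 1)
    (hlow : ∀ y : E, -(θ * ‖y‖ ^ 2) ≤ RCLike.re ⟪y, T y⟫_𝕜) (hinv : ∀ y : E, ‖y‖ ≤ B * ‖T y‖) (i : Fin n) :
    B⁻¹ ≤ hT.eigenvalues hn i := by
  set b := hT.eigenvectorBasis hn with hb
  set lam := hT.eigenvalues hn i with hlam
  have hTb : T (b i) = (lam : 𝕜) • b i := hT.apply_eigenvectorBasis hn i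
  have hnorm : ‖b i‖ = 1 := b.orthonormal.1 i
  -- `|λ| ≥ 1/B` from the inverse bound at the unit eigenvector
  have h1 : 1 ≤ B * |lam| := by
    have := hinv (b i)
    rw [hTb, norm_smul, hnorm, mul_one, RCLike.norm_ofReal] at this
    simpa using this
  -- `λ ≥ −θ` from almost-positivity at the unit eigenvector
  have h2 : -θ ≤ lam := by
    have := hlow (b i)
    rw [hTb, inner_smul_right, inner_self_eq_norm_sq_to_K, hnorm] at this
    simpa using this
  have hBi : 0 < B⁻¹ := inv_pos.mpr hB
  have hθ : θ < B⁻¹ := by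
    have : θ = (θ * B) * B⁻¹ := by field_simp
    rw [this]
    calc θ * B * B⁻¹ < 1 * B⁻¹ := mul_lt_mul_of_pos_right hθB hBi
      _ = B⁻¹ := one_mul _
  have h1' : B⁻¹ ≤ |lam| := by
    calc B⁻¹ = B⁻¹ * 1 := (mul_one _).symm
      _ ≤ B⁻¹ * (B * |lam|) := mul_le_mul_of_nonneg_left h1 hBi.le
      _ = |lam| := by field_simp
  rcases le_or_gt 0 lam with hpos | hneg
  · rwa [abs_of_nonneg hpos] at h1'
  · rw [abs_of_neg hneg] at h1'
    linarith

/-- ★★★ **COERCIVITY FROM ALMOST-POSITIVITY AND AN INVERSE BOUND.**  For a symmetric operator `T` on a finite-dimensional inner-product space: if `re⟨y,Ty⟩ ≥ −θ‖y‖²` and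
`‖y‖ ≤ B‖Ty‖` for all `y`, with `B > 0` and `θB < 1`, then `B⁻¹‖y‖² ≤ re⟨y,Ty⟩` for all `y` — [Balaban1985BackgroundPropagators] Thm 3.11's argument («symmetric and invertible
… if it is not positive … contradiction») made quantitative: invertibility with `‖T⁻¹‖ ≤ B` plus an a-priori lower bound `> −1∕B` IS coercivity with constant `1∕B`.
[cite: Balaban1985BackgroundPropagators, Thm 3.11 p.416, Thm 3.3 p.399] -/
theorem re_inner_ge_of_almostPos_of_inv_bound {T : E →ₗ[𝕜] E} (hT : T.IsSymmetric)
    {θ B : ℝ} (hB : 0 < B) (hθB : θ * B < 1)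
    (hlow : ∀ y : E, -(θ * ‖y‖ ^ 2) ≤ RCLike.re ⟪y, T y⟫_𝕜) (hinv : ∀ y : E, ‖y‖ ≤ B * ‖T y‖) (y : E) :
    B⁻¹ * ‖y‖ ^ 2 ≤ RCLike.re ⟪y, T y⟫_𝕜 := by
  obtain ⟨n, hn⟩ : ∃ n, Module.finrank 𝕜 E = n := ⟨_, rfl⟩
  rw [re_inner_eq_sum_eigenvalues hT hn y]
  have hy : ‖y‖ ^ 2 = ∑ i, ‖(hT.eigenvectorBasis hn).repr y i‖ ^ 2 := by
    rw [← (hT.eigenvectorBasis hn).repr.norm_map y, PiLp.norm_sq_eq_of_L2]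
  rw [hy, Finset.mul_sum]
  exact Finset.sum_le_sum fun i _ =>
    mul_le_mul_of_nonneg_right (eigenvalues_ge_of_almostPos_of_inv_bound hT hn hB hθB hlow hinv i) (sq_nonneg _)

/-- **The positive case `θ = 0`**: `re⟨y,Ty⟩ ≥ 0` and `‖y‖ ≤ B‖Ty‖` for all `y` give `B⁻¹‖y‖² ≤ re⟨y,Ty⟩` (cf. lit ✓`B13CoerciveIffPosDefInverseBound` on the `trIP` carrier:
«coercive ⟺ positive definite ∧ inverse form-bounded»). [cite: Balaban1985BackgroundPropagators, Thm 3.11 p.416] -/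
theorem re_inner_ge_of_nonneg_of_inv_bound {T : E →ₗ[𝕜] E} (hT : T.IsSymmetric)
    {B : ℝ} (hB : 0 < B) (hpos : ∀ y : E, 0 ≤ RCLike.re ⟪y, T y⟫_𝕜) (hinv : ∀ y : E, ‖y‖ ≤ B * ‖T y‖) (y : E) :
    B⁻¹ * ‖y‖ ^ 2 ≤ RCLike.re ⟪y, T y⟫_𝕜 :=
  re_inner_ge_of_almostPos_of_inv_bound hT (θ := 0) hB (by rw [zero_mul]; exact zero_lt_one) (fun y => by simpa using hpos y) hinv y

/-- **An `L²`-bounded right inverse gives the inverse bound** (finite dimension: a right inverse is a left inverse): `T∘S = id` and `‖Sf‖ ≤ B‖f‖` for all `f` imply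
`‖y‖ ≤ B‖Ty‖` for all `y` — the form in which a displayed `norm_G₀` row («`‖G₀(U₀)f‖ ≤ B₀‖f‖`», [Balaban1985BackgroundPropagators] Thm 3.3 (3.46)–(3.47) for `G = Δ_a⁻¹`)
enters §1. [cite: Balaban1985BackgroundPropagators, (3.27) p.395, Thm 3.3 p.399] -/
theorem inv_bound_of_rightInverse (T S : E →ₗ[𝕜] E) (hTS : T ∘ₗ S = LinearMap.id) {B : ℝ} (hSB : ∀ f, ‖S f‖ ≤ B * ‖f‖) (y : E) :
    ‖y‖ ≤ B * ‖T y‖ := by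
  have h1 : T * S = 1 := hTS
  have hST : S * T = 1 := mul_eq_one_comm.mp h1
  have : S (T y) = y := by
    have := congrArg (fun f => f y) hST
    simpa using this
  calc ‖y‖ = ‖S (T y)‖ := by rw [this]
    _ ≤ B * ‖T y‖ := hSB _

end Abstract

/-! ## §2 The member's `Δ_a(U₀) = Δx(U₀) + D_{U₀} R_S(U₀) D*_{U₀} + Q_k† a Q_k` ([Balaban1985BackgroundPropagators] (3.26)) -/

section Member

variable (F : T3Family) (n K : ℕ) (h : n ≤ K) (c₀ cB a : ℝ) [Fact (0 < c₀)] [Fact (0 < cB)]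
  (Δx : GaugeField (F.P K) 0 (Matrix.specialUnitaryGroup (Fin 2) ℂ) → (BondL2K ℂ 3 (periodsT3 F K) c₀ W₂ →ₗ[ℂ] BondL2K ℂ 3 (periodsT3 F K) c₀ W₂))

omit [Fact (0 < cB)] in
/-- **The `DRD*` penalty is a square**: `re⟨u, R_S u⟩ = ‖R_S u‖²` (`R_S` symmetric and idempotent). [cite: Balaban1985BackgroundPropagators, (3.21) p.394, (3.26) p.395] -/
theorem re_inner_RS_self (U₀ : GaugeField (F.P K) 0 (Matrix.specialUnitaryGroup (Fin 2) ℂ)) (u : SiteL2K ℂ 3 (periodsT3 F K) c₀ W₂) :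
    RCLike.re ⟪u, RS F n K h c₀ cB U₀ u⟫_ℂ = ‖RS F n K h c₀ cB U₀ u‖ ^ 2 := by
  have h1 : ⟪u, RS F n K h c₀ cB U₀ u⟫_ℂ = ⟪RS F n K h c₀ cB U₀ u, RS F n K h c₀ cB U₀ u⟫_ℂ := by
    conv_lhs => rw [← RS_RS U₀ u]
    exact (RS_isSymmetric U₀ u (RS F n K h c₀ cB U₀ u)).symm
  rw [h1, inner_self_eq_norm_sq_to_K]
  norm_cast

/-- ★ **THE QUADRATIC FORM OF `Δ_a(U₀)`, THREE TERMS**: `re⟨y, Δ_a y⟩ = re⟨y, Δx y⟩ + ‖R_S D*y‖² + a·‖Q_k y‖²` for every `y` (no gauge condition) — (3.26) paired with `y`, the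
adjunctions `D* = D†`, `Q* = Q†`. [cite: Balaban1985BackgroundPropagators, (3.26) p.395, (3.8) p.392, p.391] -/
theorem re_inner_laplaceA_eq (U₀ : GaugeField (F.P K) 0 (Matrix.specialUnitaryGroup (Fin 2) ℂ)) (y : BondL2K ℂ 3 (periodsT3 F K) c₀ W₂) :
    RCLike.re ⟪y, laplaceA F n K h c₀ cB a Δx U₀ y⟫_ℂ
      = RCLike.re ⟪y, Δx U₀ y⟫_ℂ + ‖RS F n K h c₀ cB U₀ (DstarL2 F n K c₀ U₀ y)‖ ^ 2 + a * ‖Qk F n K h c₀ cB U₀ y‖ ^ 2 := by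
  rw [laplaceA_eq_laplaceAK, laplaceAK_apply, inner_add_right, inner_add_right, map_add, map_add]
  have h2 : ⟪y, DL2 F n K c₀ U₀ (RS F n K h c₀ cB U₀ (DstarL2 F n K c₀ U₀ y))⟫_ℂ
      = ⟪DstarL2 F n K c₀ U₀ y, RS F n K h c₀ cB U₀ (DstarL2 F n K c₀ U₀ y)⟫_ℂ := by
    rw [← adjoint_DL2, LinearMap.adjoint_inner_left]
  have h3 : RCLike.re ⟪y, LinearMap.adjoint (Qk F n K h c₀ cB U₀) ((((a : ℝ) : ℂ)) • Qk F n K h c₀ cB U₀ y)⟫_ℂ = a * ‖Qk F n K h c₀ cB U₀ y‖ ^ 2 := by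
    rw [LinearMap.adjoint_inner_right, inner_smul_right, inner_self_eq_norm_sq_to_K]
    change RCLike.re (((a : ℝ) : ℂ) * (((‖Qk F n K h c₀ cB U₀ y‖ : ℝ) : ℂ)) ^ 2) = _
    simp only [RCLike.re_to_complex, ← Complex.ofReal_pow, ← Complex.ofReal_mul, Complex.ofReal_re]
  rw [h2, re_inner_RS_self, h3]

/-- **Almost-positivity of `Δ_a(U₀)` is almost-positivity of the Hessian letter**: the two penalties are non-negative (`a ≥ 0`), so `re⟨y, Δx(U₀)y⟩ ≥ −θ‖y‖²` for all `y` gives the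
same for `Δ_a(U₀)` — for print's `Δ^η = 𝒟*𝒟 + Δ′` ((3.10)) `θ = ‖Δ′‖`, small on the regular class. [cite: Balaban1985BackgroundPropagators, (3.10) p.392, (3.26) p.395] -/
theorem almostPos_laplaceA_of_almostPos (U₀ : GaugeField (F.P K) 0 (Matrix.specialUnitaryGroup (Fin 2) ℂ)) (ha : 0 ≤ a) {θ : ℝ}
    (hθ : ∀ y : BondL2K ℂ 3 (periodsT3 F K) c₀ W₂, -(θ * ‖y‖ ^ 2) ≤ RCLike.re ⟪y, Δx U₀ y⟫_ℂ) (y : BondL2K ℂ 3 (periodsT3 F K) c₀ W₂) :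
    -(θ * ‖y‖ ^ 2) ≤ RCLike.re ⟪y, laplaceA F n K h c₀ cB a Δx U₀ y⟫_ℂ := by
  rw [re_inner_laplaceA_eq]
  have h1 := hθ y
  have h2 : 0 ≤ ‖RS F n K h c₀ cB U₀ (DstarL2 F n K c₀ U₀ y)‖ ^ 2 := sq_nonneg _
  have h3 : 0 ≤ a * ‖Qk F n K h c₀ cB U₀ y‖ ^ 2 := mul_nonneg ha (sq_nonneg _)
  linarith

/-- ★★★ **THE QUANTITATIVE COERCIVITY ROW OF `Δ_a(U₀)` FROM ALMOST-POSITIVITY AND AN `L²` INVERSE BOUND** (RULING g28-№13 (2)'s row, in the form LOCATE-RCORE (R2) locates it):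
if the Hessian letter `Δx(U₀)` is symmetric with `re⟨y, Δx(U₀)y⟩ ≥ −θ‖y‖²`, and `Δ_a(U₀)` has a right inverse `G₀` with `‖G₀f‖ ≤ B‖f‖` (`B > 0`, `θB < 1`, `a ≥ 0`), then
`B⁻¹·‖y‖² ≤ re⟨y, Δ_a(U₀)y⟩` for every `y` — [Balaban1985BackgroundPropagators] Thm 3.11 for `Δ_a` from Thm 3.3's `L²` bound for `G = Δ_a⁻¹`, with the constant `γ = 1∕B` BY NAME.
[cite: Balaban1985BackgroundPropagators, Thm 3.11 p.416, Thm 3.3 p.399, (3.26)–(3.27) p.395] -/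
theorem coercive_laplaceA_of_almostPos_of_inverse_bound (U₀ : GaugeField (F.P K) 0 (Matrix.specialUnitaryGroup (Fin 2) ℂ))
    (hΔx : (Δx U₀).IsSymmetric) (ha : 0 ≤ a) {θ B : ℝ} (hB : 0 < B) (hθB : θ * B < 1)
    (hθ : ∀ y : BondL2K ℂ 3 (periodsT3 F K) c₀ W₂, -(θ * ‖y‖ ^ 2) ≤ RCLike.re ⟪y, Δx U₀ y⟫_ℂ)
    (G₀ : BondL2K ℂ 3 (periodsT3 F K) c₀ W₂ →ₗ[ℂ] BondL2K ℂ 3 (periodsT3 F K) c₀ W₂)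
    (hG : laplaceA F n K h c₀ cB a Δx U₀ ∘ₗ G₀ = LinearMap.id) (hGB : ∀ f, ‖G₀ f‖ ≤ B * ‖f‖)
    (y : BondL2K ℂ 3 (periodsT3 F K) c₀ W₂) :
    B⁻¹ * ‖y‖ ^ 2 ≤ RCLike.re ⟪y, laplaceA F n K h c₀ cB a Δx U₀ y⟫_ℂ :=
  re_inner_ge_of_almostPos_of_inv_bound (laplaceA_isSymmetric (h := h) (cB := cB) (a := a) hΔx) hB hθB
    (almostPos_laplaceA_of_almostPos F n K h c₀ cB a Δx U₀ ha hθ) (inv_bound_of_rightInverse _ G₀ hG hGB) y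

/-- **The EX display's QUALITATIVE `hPosΔ` shape from the same two rows**: `0 < re⟨x, Δ_a(U₀)x⟩` for `x ≠ 0`.
[cite: Balaban1985BackgroundPropagators, Thm 3.11 p.416] -/
theorem pos_laplaceA_of_almostPos_of_inverse_bound (U₀ : GaugeField (F.P K) 0 (Matrix.specialUnitaryGroup (Fin 2) ℂ))
    (hΔx : (Δx U₀).IsSymmetric) (ha : 0 ≤ a) {θ B : ℝ} (hB : 0 < B) (hθB : θ * B < 1)
    (hθ : ∀ y : BondL2K ℂ 3 (periodsT3 F K) c₀ W₂, -(θ * ‖y‖ ^ 2) ≤ RCLike.re ⟪y, Δx U₀ y⟫_ℂ)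
    (G₀ : BondL2K ℂ 3 (periodsT3 F K) c₀ W₂ →ₗ[ℂ] BondL2K ℂ 3 (periodsT3 F K) c₀ W₂)
    (hG : laplaceA F n K h c₀ cB a Δx U₀ ∘ₗ G₀ = LinearMap.id) (hGB : ∀ f, ‖G₀ f‖ ≤ B * ‖f‖)
    (x : BondL2K ℂ 3 (periodsT3 F K) c₀ W₂) (hx : x ≠ 0) :
    0 < RCLike.re ⟪x, laplaceA F n K h c₀ cB a Δx U₀ x⟫_ℂ := by
  have h1 := coercive_laplaceA_of_almostPos_of_inverse_bound F n K h c₀ cB a Δx U₀ hΔx ha hB hθB hθ G₀ hG hGB x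
  have h2 : 0 < B⁻¹ * ‖x‖ ^ 2 := mul_pos (inv_pos.mpr hB) (pow_pos (norm_pos_iff.mpr hx) 2)
  linarith

/-- ★★ **THE K-ONLY HESSIAN ON PRINT'S SLICE ∩ `ker Q_k` FROM THE TWO ROWS** (composition with ✓`Prop7HessOnPrintSlice.hess_of_laplaceA_coercive_of_isLandauPrintS_of_ker`): for every
route field `X` with `IsLandauPrintS U₀ X` and `Q_k(U₀)X̃ = 0`, `B⁻¹‖X̃‖² ≤ re⟨X̃, Δx(U₀)X̃⟩` — [Balaban1985Variational] p.299 (141)–(142) with print's own Thm 3.11 route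
(inverse bound + almost-positivity) supplying the positivity. [cite: Balaban1985Variational, (141)–(142) p.299; Balaban1985BackgroundPropagators, Thm 3.11 p.416, Thm 3.3 p.399] -/
theorem hess_of_almostPos_of_inverse_bound_of_isLandauPrintS_of_ker (U₀ : GaugeField (F.P K) 0 (Matrix.specialUnitaryGroup (Fin 2) ℂ))
    (hΔx : (Δx U₀).IsSymmetric) (ha : 0 ≤ a) {θ B : ℝ} (hB : 0 < B) (hθB : θ * B < 1)
    (hθ : ∀ y : BondL2K ℂ 3 (periodsT3 F K) c₀ W₂, -(θ * ‖y‖ ^ 2) ≤ RCLike.re ⟪y, Δx U₀ y⟫_ℂ)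
    (G₀ : BondL2K ℂ 3 (periodsT3 F K) c₀ W₂ →ₗ[ℂ] BondL2K ℂ 3 (periodsT3 F K) c₀ W₂)
    (hG : laplaceA F n K h c₀ cB a Δx U₀ ∘ₗ G₀ = LinearMap.id) (hGB : ∀ f, ‖G₀ f‖ ≤ B * ‖f‖)
    (X : PBond (F.P K) 0 → Matrix (Fin 2) (Fin 2) ℂ) (hX : IsLandauPrintS F n K h c₀ cB U₀ X) (hQ : Qk F n K h c₀ cB U₀ (toL2 F K c₀ X) = 0) :
    B⁻¹ * ‖toL2 F K c₀ X‖ ^ 2 ≤ RCLike.re ⟪toL2 F K c₀ X, Δx U₀ (toL2 F K c₀ X)⟫_ℂ :=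
  hess_of_laplaceA_coercive_of_isLandauPrintS_of_ker F n K h c₀ cB a Δx U₀
    (coercive_laplaceA_of_almostPos_of_inverse_bound F n K h c₀ cB a Δx U₀ hΔx ha hB hθB hθ G₀ hG hGB) X hX hQ

end Member


/-! ## §3 (v1.1 append, w4 g8) THE CONVERSE DIRECTION AND THE INVERSE-FREE LETTER
(★p1 g17 WORD 13 ∕ px13 g4 LOCATE «THM311-SOCKET» 417ee27c: the displayed row may be lettered inverse-free as «`∀ f, ‖f‖ ≤ B₀·‖Δ_a(U₀) f‖`», which is what §1 consumes and
is not vacuous off the class where a total `G`-letter is junk; and RULING g28-№13 (c3′)'s flat certificate «`‖G₀(1)‖ ≤ γ_flat⁻¹`» is the trivial direction COERC ⟹ inverse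
bound — lit ✓`B13CoerciveIffPosDefInverseBound.ringInverse_formBound_of_coer` on the `trIP` carrier, here on `InnerProductSpace`.) -/

section AbstractConverse

variable {𝕜 : Type*} [RCLike 𝕜] {E : Type*} [NormedAddCommGroup E] [InnerProductSpace 𝕜 E]

/-- ★ **COERCIVITY ⟹ THE INVERSE-FREE BOUND** (one Cauchy–Schwarz): `γ‖y‖² ≤ re⟨y,Ty⟩` for all `y` with `γ > 0` gives `‖y‖ ≤ γ⁻¹‖Ty‖` for all `y` — the direction in which a
PROVED coercivity (e.g. the flat ✓`Prop7FlatCoercivityR.flat_coercive_R_T3`) certifies a displayed inverse-bound row (RULING g28-№13 (c3′)). [folklore]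
[cite: Balaban1985BackgroundPropagators, Thm 3.11 p.416; Balaban1984PropagatorsI, Prop. 1.1 (1.90) p.33] -/
theorem inv_bound_of_coercive (T : E →ₗ[𝕜] E) {γ : ℝ} (hγ : 0 < γ) (hco : ∀ y : E, γ * ‖y‖ ^ 2 ≤ RCLike.re ⟪y, T y⟫_𝕜) (y : E) :
    ‖y‖ ≤ γ⁻¹ * ‖T y‖ := by
  have h1 : γ * ‖y‖ ^ 2 ≤ ‖y‖ * ‖T y‖ :=
    (hco y).trans ((RCLike.re_le_norm _).trans (norm_inner_le_norm _ _))
  by_cases hy : ‖y‖ = 0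
  · rw [hy]; positivity
  · have hpos : 0 < ‖y‖ := lt_of_le_of_ne (norm_nonneg _) (Ne.symm hy)
    have h2 : γ * ‖y‖ ≤ ‖T y‖ := by
      rw [pow_two, ← mul_assoc] at h1
      exact le_of_mul_le_mul_right (by linarith [h1, mul_comm (γ * ‖y‖) ‖y‖]) hpos
    calc ‖y‖ = γ⁻¹ * (γ * ‖y‖) := by field_simp
      _ ≤ γ⁻¹ * ‖T y‖ := mul_le_mul_of_nonneg_left h2 (inv_pos.mpr hγ).le

/-- **COERCIVITY ⟹ A TWO-SIDED INVERSE WITH `‖T⁻¹f‖ ≤ γ⁻¹‖f‖`** (finite dimension: the inverse-free bound makes `T` injective, hence bijective): the `(G₀, Δ_a∘G₀ = id, ‖G₀f‖ ≤ B‖f‖)`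
triple §2 consumes, produced from a coercivity row — at the flat member this is (c3′)'s certificate «`‖G₀(1)‖ ≤ γ_flat⁻¹`» once the flat COERC instance is in hand. [folklore]
[cite: Balaban1985BackgroundPropagators, (3.27) p.395, Thm 3.11 p.416] -/
theorem exists_inverse_of_coercive [FiniteDimensional 𝕜 E] (T : E →ₗ[𝕜] E) {γ : ℝ} (hγ : 0 < γ)
    (hco : ∀ y : E, γ * ‖y‖ ^ 2 ≤ RCLike.re ⟪y, T y⟫_𝕜) :
    ∃ S : E →ₗ[𝕜] E, T ∘ₗ S = LinearMap.id ∧ S ∘ₗ T = LinearMap.id ∧ ∀ f : E, ‖S f‖ ≤ γ⁻¹ * ‖f‖ := by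
  have hinv := inv_bound_of_coercive T hγ hco
  have hinj : Function.Injective T := by
    intro x y hxy
    have h := hinv (x - y)
    rw [map_sub, hxy, sub_self, norm_zero, mul_zero] at h
    exact sub_eq_zero.mp (norm_le_zero_iff.mp h)
  have hbij : Function.Bijective T := ⟨hinj, LinearMap.surjective_of_injective hinj⟩
  let e : E ≃ₗ[𝕜] E := LinearEquiv.ofBijective T hbij
  refine ⟨e.symm.toLinearMap, ?_, ?_, fun f => ?_⟩
  · ext f; exact e.apply_symm_apply f
  · ext y; exact e.symm_apply_apply y
  · have h := hinv (e.symm f)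
    have he : T (e.symm f) = f := e.apply_symm_apply f
    rw [he] at h
    exact h

/-- ★★ **THE INVERSE-FREE FORM OF §1**: symmetric `T`, `re⟨y,Ty⟩ ≥ −θ‖y‖²`, `‖y‖ ≤ B‖Ty‖` (`B > 0`, `θB < 1`) ⟹ `B⁻¹‖y‖² ≤ re⟨y,Ty⟩` — restated so that the displayed row can be the
inverse-free letter «`∀ f, ‖f‖ ≤ B₀·‖Δ_a(U₀)f‖`» (px13 g4 THM311-SOCKET (L5): not vacuous where a total inverse letter is junk). [cite: Balaban1985BackgroundPropagators, Thm 3.11 p.416] -/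
theorem re_inner_ge_of_almostPos_of_inv_bound' [FiniteDimensional 𝕜 E] {T : E →ₗ[𝕜] E} (hT : T.IsSymmetric)
    {θ B : ℝ} (hB : 0 < B) (hθB : θ * B < 1)
    (hlow : ∀ y : E, -(θ * ‖y‖ ^ 2) ≤ RCLike.re ⟪y, T y⟫_𝕜) (hinv : ∀ y : E, ‖y‖ ≤ B * ‖T y‖) (y : E) :
    B⁻¹ * ‖y‖ ^ 2 ≤ RCLike.re ⟪y, T y⟫_𝕜 :=
  re_inner_ge_of_almostPos_of_inv_bound hT hB hθB hlow hinv y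

end AbstractConverse

section MemberConverse

variable (F : T3Family) (n K : ℕ) (h : n ≤ K) (c₀ cB a : ℝ) [Fact (0 < c₀)] [Fact (0 < cB)]
  (Δx : GaugeField (F.P K) 0 (Matrix.specialUnitaryGroup (Fin 2) ℂ) → (BondL2K ℂ 3 (periodsT3 F K) c₀ W₂ →ₗ[ℂ] BondL2K ℂ 3 (periodsT3 F K) c₀ W₂))

/-- ★★★ **THE COERCIVITY ROW FROM THE INVERSE-FREE LETTER**: `Δx(U₀)` symmetric with `re⟨y, Δx(U₀)y⟩ ≥ −θ‖y‖²`, `0 ≤ a`, and «`∀ f, ‖f‖ ≤ B·‖Δ_a(U₀)f‖`» (`B > 0`, `θB < 1`)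
give `B⁻¹·‖y‖² ≤ re⟨y, Δ_a(U₀)y⟩` for every `y` — §2's row with the display letter px13 g4 recommends. [cite: Balaban1985BackgroundPropagators, Thm 3.11 p.416, Thm 3.3 p.399, (3.26) p.395] -/
theorem coercive_laplaceA_of_almostPos_of_inv_bound (U₀ : GaugeField (F.P K) 0 (Matrix.specialUnitaryGroup (Fin 2) ℂ))
    (hΔx : (Δx U₀).IsSymmetric) (ha : 0 ≤ a) {θ B : ℝ} (hB : 0 < B) (hθB : θ * B < 1)
    (hθ : ∀ y : BondL2K ℂ 3 (periodsT3 F K) c₀ W₂, -(θ * ‖y‖ ^ 2) ≤ RCLike.re ⟪y, Δx U₀ y⟫_ℂ)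
    (hinv : ∀ f : BondL2K ℂ 3 (periodsT3 F K) c₀ W₂, ‖f‖ ≤ B * ‖laplaceA F n K h c₀ cB a Δx U₀ f‖)
    (y : BondL2K ℂ 3 (periodsT3 F K) c₀ W₂) :
    B⁻¹ * ‖y‖ ^ 2 ≤ RCLike.re ⟪y, laplaceA F n K h c₀ cB a Δx U₀ y⟫_ℂ :=
  re_inner_ge_of_almostPos_of_inv_bound (laplaceA_isSymmetric (h := h) (cB := cB) (a := a) hΔx) hB hθB
    (almostPos_laplaceA_of_almostPos F n K h c₀ cB a Δx U₀ ha hθ) hinv y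

/-- ★ **COERC ⟹ THE INVERSE-FREE ROW** at the member: a coercivity row `γ‖y‖² ≤ re⟨y, Δ_a(U₀)y⟩` (`γ > 0`) gives «`‖f‖ ≤ γ⁻¹·‖Δ_a(U₀)f‖`» — the (c3′) direction: at `U₀ = 1`
the flat COERC instance (px6 g5's seams over ✓`flat_coercive_R_T3`) certifies the displayed inverse-bound row with `B₀(1) := γ_flat⁻¹`. [cite: Balaban1984PropagatorsI, Prop. 1.1 (1.90) p.33; Balaban1985BackgroundPropagators, Thm 3.11 p.416] -/
theorem inv_bound_laplaceA_of_coercive (U₀ : GaugeField (F.P K) 0 (Matrix.specialUnitaryGroup (Fin 2) ℂ)) {γ : ℝ} (hγ : 0 < γ)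
    (hco : ∀ y : BondL2K ℂ 3 (periodsT3 F K) c₀ W₂, γ * ‖y‖ ^ 2 ≤ RCLike.re ⟪y, laplaceA F n K h c₀ cB a Δx U₀ y⟫_ℂ)
    (f : BondL2K ℂ 3 (periodsT3 F K) c₀ W₂) :
    ‖f‖ ≤ γ⁻¹ * ‖laplaceA F n K h c₀ cB a Δx U₀ f‖ :=
  inv_bound_of_coercive _ hγ hco f

/-- ★ **COERC ⟹ A BOUNDED TWO-SIDED INVERSE `G₀` OF `Δ_a(U₀)`** with `‖G₀ f‖ ≤ γ⁻¹‖f‖` (finite dimension) — the `(G₀, Δ_a∘G₀ = id, ‖G₀·‖ ≤ B‖·‖)` triple of §2 from a coercivity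
row; at `U₀ = 1`, (c3′)'s «`‖G₀(1)‖ ≤ γ_flat⁻¹`». [cite: Balaban1985BackgroundPropagators, (3.27) p.395, Thm 3.11 p.416] -/
theorem exists_G₀_of_coercive (U₀ : GaugeField (F.P K) 0 (Matrix.specialUnitaryGroup (Fin 2) ℂ)) {γ : ℝ} (hγ : 0 < γ)
    (hco : ∀ y : BondL2K ℂ 3 (periodsT3 F K) c₀ W₂, γ * ‖y‖ ^ 2 ≤ RCLike.re ⟪y, laplaceA F n K h c₀ cB a Δx U₀ y⟫_ℂ) :
    ∃ G₀ : BondL2K ℂ 3 (periodsT3 F K) c₀ W₂ →ₗ[ℂ] BondL2K ℂ 3 (periodsT3 F K) c₀ W₂,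
      laplaceA F n K h c₀ cB a Δx U₀ ∘ₗ G₀ = LinearMap.id ∧ G₀ ∘ₗ laplaceA F n K h c₀ cB a Δx U₀ = LinearMap.id ∧
      ∀ f : BondL2K ℂ 3 (periodsT3 F K) c₀ W₂, ‖G₀ f‖ ≤ γ⁻¹ * ‖f‖ :=
  exists_inverse_of_coercive _ hγ hco

end MemberConverse

end Summit.QuantumFields.YangMills.Theorems.Prop7CoerciveOfInverseBound

end
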